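import Summits.QuantumFields.BalabanUV.Beta.GAN24.StaircaseFaces

/-!
# `BalabanUV.Beta.GAN24.ContactTentFaceAvg` — binder row G-an2-4 / (CONV-C), the row owner's CONTACT-TERM ROUTE, CT-4c SHAPE P (leaf-01 g61's split
# `HOME/b2b-balaban-gan24-formalise-leaf-01/g61/CT4CE-BLUEPRINT-v0.md` §3 (P1)(ii) ∕ §5 M5, taken by the road-P2 chair): **THE TRANSPORTED PAIRING IS A COARSE
# PAIRING, EXACTLY** — on the FAR `κ`-FACE of every `P`-cell the taller tower's tent `𝒬ᵀ_{P·N} φ′` equals `P ·` the COARSE tent `𝒬ᵀ_N φ′` of the SAME unit-lattice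
# kernel (no wobble, no remainder), so a fine′ staircase pairing whose two staircases are cell-constant IS `P^{d+1} ×` the coarse pairing with the tent `𝒬ᵀ_N φ′`.

NOT IN PRINT; OUR BOOKKEEPING (road-P2 chair `b2b-balaban-gan24-p2`, gen 34; «MINE (CT-4c-P)» journal 2026-08-21T19:46Z; generic `d`, pure lattice algebra).
HONEST FRAMING (cell contract, verbatim): «discharging `BetaPertH` makes Bałaban's UV stability UNCONDITIONAL — a real constructive-QFT result; it is NOT the
continuum limit and NOT the Clay problem.»  HONEST DEPENDENCY (verbatim): «continuum YM on T⁴ ⇐ BetaPertH ∧ nine spine estimates (0/9 proved); BetaPertH ⇐ (D1) ∧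
(D4) ∧ CAP+tail; G-an2-4 gates asym, D1 and NE2/3/4.»

WHY (CT4-DESIGN §2 (γ) at the pairing level; leaf-01's attack surface (a)).  The owner's `StaircasePairing.abs_pairing_le_sum` NEEDS its tent slot in the form
`t = 𝒬ᵀ_N φ` (the `s₁ > s₂` branch undoes the contour sum); a structureless remainder `r` in that slot costs `N·sup|r|`.  When the shorter tower's pairing
`Σ'_u t κ u·ψmid·Δ_κχ` is compared with the taller tower's `Σ'_{u′} t′ κ u′·ψ′mid·Δ_κχ′` through the bracket with the shorter tower's staircases TRANSPORTED to the
fine′ lattice (`ψ ∘ blk P`, `χ ∘ blk P`, cell-constant), only the far-face sites `u′` of each cell see a jump of `χ ∘ blk P`, and there `t′ = 𝒬ᵀ_{P·N} φ′` takes the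
value `P·(𝒬ᵀ_N φ′)(blk P u′)` IDENTICALLY (write the contour index `s′ = P·s + r`: `quo P (u′ − s′e_κ) = blk P u′ − s·e_κ` because the offset's `κ`-component is
`P − 1 − r ∈ [0, P)`).  Hence that bracket IS a COARSE pairing with tent `𝒬ᵀ_N (P^{d+1}·φ′)`, and its difference with the shorter tower's pairing is the coarse pairing
with tent `𝒬ᵀ_N (P^{d+1}·φ′ − c·φ)` — the 𝒬ᵀ STRUCTURE IS KEPT FOR THE WHOLE DIFFERENCE, whose kernel `P^{d+1}·φ′ − c·φ` is this lineage's CT-4d letter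
(`ContactTentCauchy.abs_unitTent_sub_le`, θ_K-small at the right currency `c`).
* §1 `toSite_update_mem`, `farFace_site_eq` (the site algebra `P•w + r − (P·s + j)•e_κ = P•(w − s•e_κ) + r′`, `r′ = update r κ (P−1−j) ∈ box`), `quo_farFace_sub`
  (`quo P (…) = w − s•e_κ`); `blk_cell_add_unitVec` (the label of the `κ`-neighbour of a cell site: `if r κ = P−1 then w + e_κ else w`; the site's own label is lit-balaban's `blk_block`).
* §2 **`contourSumAdj_mul_apply_farFace`**: `r ∈ box (d+1) P`, `r κ = P − 1` ⟹ `contourSumAdj (P·N) φ′ κ (P•w + toSite r) = P · contourSumAdj N φ′ κ w`;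
  `sum_farFace_contourSumAdj_mul`: the face sum `= P^d·P · contourSumAdj N φ′ κ w` (leaf-01∕owner's `card_box_filter_last`).
* §3 **`tsum_transport_pairingReading_eq`** (any fine′ 1-form `t′`, any coarse `F G`, any bond reading `θ₀·F u + θ₁·F (u+e_κ)` as in leaf-03's `StaircasePairingReadings`;
  summable summand): `Σ'_{u′} t′ κ u′·(θ₀·F (blk P u′) + θ₁·F (blk P (u′+e_κ)))·(G (blk P (u′+e_κ)) − G (blk P u′)) = Σ'_w (Σ_{r ∈ box, r κ = P−1} t′ κ (P•w + toSite r))·(θ₀·F w + θ₁·F (w+e_κ))·(G (w+e_κ) − G w)`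
  (cell decomposition `BiStencilZeroMode.tsum_eq_sum_box_tsum`; off the far face the transported jump vanishes); **`tsum_transport_pairingReading_contourSumAdj`**: with
  `t′ = 𝒬ᵀ_{P·N} φ′` the right side is `P^d·P · Σ'_w (𝒬ᵀ_N φ′) κ w·(θ₀·F w + θ₁·F (w+e_κ))·Δ_κG`; **`tsum_transport_pairing_contourSumAdj`** (the owner's midpoint reading `(F u + F (u+e_κ))∕2`).
[folklore] throughout; 0 `def`, 0 cited facts, 0 `def … : Prop`, 0 sorry.  NO estimate; discharges NOTHING of hSdev (M4 `ContactRefineP` and the owner's CT-4e compose);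
0 wall binders; NEVER «G-an2-4 closed»; NOT (CONV-C) as typed, NOT D1, NOT BetaPertH, NOT continuum, NOT Clay.
-/

noncomputable section

open Finset
open scoped BigOperators
open Literature.MathematicalPhysics.QuantumFieldTheory
open Literature.MathematicalPhysics.QuantumFieldTheory.LatticeForm (quo)
open Literature.MathematicalPhysics.QuantumFieldTheory.Balaban1983to89
open Literature.MathematicalPhysics.QuantumFieldTheory.Balaban1983to89.Beta
open AffineAveraging (Form0 Form1 Site box toSite unitVec unitVec_apply)
open AffineReproduction (contourSumAdj)
open AveragingContours (blk blk_block)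
open KKTFluctuationEnergy (contourSumAdj_eq)
open Summit.QuantumFields.BalabanUV.Beta.GAN24.BiStencilZeroMode (tsum_eq_sum_box_tsum)
open Summit.QuantumFields.BalabanUV.Beta.GAN24.StaircaseFaces (card_box_filter_last quo_quo)

namespace Summit.QuantumFields.BalabanUV.Beta.GAN24.ContactTentFaceAvg

variable {d : ℕ}

/-! ## §1 Site algebra of a cell, its far face and its `κ`-neighbours -/

/-- [folklore] Membership in the box, componentwise. -/
theorem mem_box_iff {P : ℕ} {r : Fin (d + 1) → ℕ} : r ∈ box (d + 1) P ↔ ∀ i, r i < P := by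
  simp [AffineAveraging.box, Fintype.mem_piFinset, Finset.mem_range]

/-- [folklore] Updating one coordinate of a box offset to a value `< P` stays in the box. -/
theorem update_mem_box {P : ℕ} {r : Fin (d + 1) → ℕ} (hr : r ∈ box (d + 1) P) (κ : Fin (d + 1)) {a : ℕ} (ha : a < P) :
    Function.update r κ a ∈ box (d + 1) P := by
  rw [mem_box_iff] at hr ⊢
  intro i
  by_cases hi : i = κ
  · subst hi; rw [Function.update_self]; exact ha
  · rw [Function.update_of_ne hi]; exact hr i

/-- [folklore] **THE FAR-FACE SITE ALGEBRA**: for `r` on the far `κ`-face (`r κ = P − 1`) and a contour index `P·s + j`, `j < P`,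
`P•w + toSite r − (P·s + j)•e_κ = P•(w − s•e_κ) + toSite (update r κ (P − 1 − j))`. -/
theorem farFace_site_eq {P : ℕ} {r : Fin (d + 1) → ℕ} (κ : Fin (d + 1)) (hrκ : r κ = P - 1) (w : Site (d + 1)) (s j : ℕ) (hj : j < P) :
    (P : ℤ) • w + toSite r - (((P * s + j : ℕ) : ℤ)) • unitVec κ
      = (P : ℤ) • (w - (s : ℤ) • unitVec κ) + toSite (Function.update r κ (P - 1 - j)) := by
  funext i
  simp only [Pi.add_apply, Pi.sub_apply, Pi.smul_apply, smul_eq_mul, unitVec_apply, toSite]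
  by_cases hi : i = κ
  · subst hi
    rw [if_pos rfl, Function.update_self, hrκ]
    push_cast [Nat.cast_sub (show j ≤ P - 1 by omega), Nat.cast_sub (show 1 ≤ P by omega)]
    ring
  · rw [if_neg hi, Function.update_of_ne hi]
    ring

/-- [folklore] … hence its `P`-cell label is `w − s•e_κ`. -/
theorem quo_farFace_sub {P : ℕ} [NeZero P] {r : Fin (d + 1) → ℕ} (hr : r ∈ box (d + 1) P) (κ : Fin (d + 1)) (hrκ : r κ = P - 1)
    (w : Site (d + 1)) (s j : ℕ) (hj : j < P) :
    quo P ((P : ℤ) • w + toSite r - (((P * s + j : ℕ) : ℤ)) • unitVec κ) = w - (s : ℤ) • unitVec κ := by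
  rw [farFace_site_eq κ hrκ w s j hj]
  exact blk_block _ (update_mem_box hr κ (by omega))

/-- [folklore] **THE `κ`-NEIGHBOUR OF A CELL SITE**: its label is `w + e_κ` on the far `κ`-face and `w` elsewhere. -/
theorem blk_cell_add_unitVec {P : ℕ} (hP : 1 ≤ P) (w : Site (d + 1)) {r : Fin (d + 1) → ℕ} (hr : r ∈ box (d + 1) P) (κ : Fin (d + 1)) :
    blk P ((P : ℤ) • w + toSite r + unitVec κ) = if r κ = P - 1 then w + unitVec κ else w := by
  have hrκ : r κ < P := (mem_box_iff.1 hr) κ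
  split_ifs with h
  · -- on the far face the neighbour is the near-face site of the next cell
    have e : (P : ℤ) • w + toSite r + unitVec κ = (P : ℤ) • (w + unitVec κ) + toSite (Function.update r κ 0) := by
      funext i
      simp only [Pi.add_apply, Pi.smul_apply, smul_eq_mul, unitVec_apply, toSite]
      by_cases hi : i = κ
      · subst hi
        rw [if_pos rfl, Function.update_self, h]
        push_cast [Nat.cast_sub hP]
        ring
      · rw [if_neg hi, Function.update_of_ne hi]
        ring
    rw [e]
    exact blk_block _ (update_mem_box hr κ (by omega))
  · have e : (P : ℤ) • w + toSite r + unitVec κ = (P : ℤ) • w + toSite (Function.update r κ (r κ + 1)) := by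
      funext i
      simp only [Pi.add_apply, Pi.smul_apply, smul_eq_mul, unitVec_apply, toSite]
      by_cases hi : i = κ
      · subst hi
        rw [if_pos rfl, Function.update_self]
        push_cast
        ring
      · rw [if_neg hi, Function.update_of_ne hi]
        ring
    rw [e]
    exact blk_block _ (update_mem_box hr κ (by omega))

/-! ## §2 The fine′ tent on the far face IS the coarse tent -/

/-- [folklore] Reindexing a contour of length `P·n` by `s′ = P·s + j`. -/
theorem sum_range_mul_eq (g : ℕ → ℝ) (P n : ℕ) :
    ∑ x ∈ Finset.range (P * n), g x = ∑ s ∈ Finset.range n, ∑ j ∈ Finset.range P, g (P * s + j) := by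
  induction n with
  | zero => simp
  | succ n ih => rw [Nat.mul_succ, Finset.sum_range_add, ih, Finset.sum_range_succ]

/-- NOT IN PRINT; OUR BOOKKEEPING.  **ON THE FAR `κ`-FACE THE FINE′ TENT IS `P ×` THE COARSE TENT OF THE SAME KERNEL, IDENTICALLY** (generic `d`; `r ∈ box (d+1) P`,
`r κ = P − 1`): `contourSumAdj (P·N) φ′ κ (P•w + toSite r) = P · contourSumAdj N φ′ κ w` — every one of the `P` fine′ contour points `P·s + j` (`j < P`) behind the
face has `P`-label `w − s•e_κ`, hence `(P·N)`-label `quo N (w − s•e_κ)` (`quo_quo`). -/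
theorem contourSumAdj_mul_apply_farFace (P N : ℕ) [NeZero P] (φ' : Form1 (d + 1) ℝ) (κ : Fin (d + 1)) (w : Site (d + 1))
    {r : Fin (d + 1) → ℕ} (hr : r ∈ box (d + 1) P) (hrκ : r κ = P - 1) :
    contourSumAdj (P * N) φ' κ ((P : ℤ) • w + toSite r) = (P : ℝ) * contourSumAdj N φ' κ w := by
  rw [contourSumAdj_eq, contourSumAdj_eq, sum_range_mul_eq, Finset.mul_sum]
  refine Finset.sum_congr rfl fun s _ => ?_
  rw [Finset.sum_congr rfl fun j hj => by
      rw [← quo_quo, quo_farFace_sub hr κ hrκ w s j (Finset.mem_range.1 hj)],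
    Finset.sum_const, Finset.card_range, nsmul_eq_mul]

/-- NOT IN PRINT; OUR BOOKKEEPING.  **THE FACE SUM OF THE FINE′ TENT**: `Σ_{r ∈ box, r κ = P−1} contourSumAdj (P·N) φ′ κ (P•w + toSite r) = P^d·P · contourSumAdj N φ′ κ w`
(`P^d` face sites, `card_box_filter_last`). -/
theorem sum_farFace_contourSumAdj_mul {P : ℕ} (hP : 1 ≤ P) (N : ℕ) (φ' : Form1 (d + 1) ℝ) (κ : Fin (d + 1)) (w : Site (d + 1)) :
    ∑ r ∈ (box (d + 1) P).filter (fun r => r κ = P - 1), contourSumAdj (P * N) φ' κ ((P : ℤ) • w + toSite r)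
      = ((P : ℝ) ^ d * P) * contourSumAdj N φ' κ w := by
  haveI : NeZero P := ⟨by omega⟩
  rw [Finset.sum_congr rfl fun r hr =>
      contourSumAdj_mul_apply_farFace P N φ' κ w (Finset.mem_filter.1 hr).1 (Finset.mem_filter.1 hr).2,
    Finset.sum_const, card_box_filter_last hP κ, nsmul_eq_mul]
  push_cast
  ring

/-! ## §3 The transported pairing is a coarse pairing -/

/-- NOT IN PRINT; OUR BOOKKEEPING.  **CELL DECOMPOSITION OF A TRANSPORTED PAIRING, ANY BOND READING** (generic `d`, `1 ≤ P`; any fine′ 1-form `t′`, any coarse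
`F G`, reading weights `θ₀, θ₁` — midpoint `(½,½)`, tip `(0,1)`, base `(1,0)` as in leaf-03's `StaircasePairingReadings`; the summand summable):
`Σ'_{u′} t′ κ u′·(θ₀·F (blk P u′) + θ₁·F (blk P (u′+e_κ)))·(G (blk P (u′+e_κ)) − G (blk P u′))`
`= Σ'_w (Σ_{r ∈ box (d+1) P, r κ = P−1} t′ κ (P•w + toSite r))·(θ₀·F w + θ₁·F (w+e_κ))·(G (w+e_κ) − G w)` — off the far `κ`-face of its cell a fine′ site and its
`κ`-neighbour carry the same label (`blk_cell_add_unitVec`), so the transported jump vanishes there. -/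
theorem tsum_transport_pairingReading_eq {P : ℕ} (hP : 1 ≤ P) (t' : Form1 (d + 1) ℝ) (F G : Form0 (d + 1) ℝ) (θ₀ θ₁ : ℝ) (κ : Fin (d + 1))
    (hs : Summable fun u' : Site (d + 1) =>
      t' κ u' * (θ₀ * F (blk P u') + θ₁ * F (blk P (u' + unitVec κ))) * (G (blk P (u' + unitVec κ)) - G (blk P u'))) :
    ∑' u' : Site (d + 1), t' κ u' * (θ₀ * F (blk P u') + θ₁ * F (blk P (u' + unitVec κ))) * (G (blk P (u' + unitVec κ)) - G (blk P u'))
      = ∑' w : Site (d + 1), (∑ r ∈ (box (d + 1) P).filter (fun r => r κ = P - 1), t' κ ((P : ℤ) • w + toSite r))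
          * (θ₀ * F w + θ₁ * F (w + unitVec κ)) * (G (w + unitVec κ) - G w) := by
  haveI : NeZero P := ⟨by omega⟩
  rw [tsum_eq_sum_box_tsum (N := P) hs]
  -- each cell-offset slice: zero off the far face, the coarse summand on it
  have hslice : ∀ r ∈ box (d + 1) P, (fun w : Site (d + 1) =>
      t' κ ((P : ℤ) • w + toSite r) * (θ₀ * F (blk P ((P : ℤ) • w + toSite r)) + θ₁ * F (blk P ((P : ℤ) • w + toSite r + unitVec κ)))
        * (G (blk P ((P : ℤ) • w + toSite r + unitVec κ)) - G (blk P ((P : ℤ) • w + toSite r))))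
      = fun w => if r κ = P - 1 then t' κ ((P : ℤ) • w + toSite r) * (θ₀ * F w + θ₁ * F (w + unitVec κ)) * (G (w + unitVec κ) - G w) else 0 := by
    intro r hr
    funext w
    rw [blk_block w hr, blk_cell_add_unitVec hP w hr κ]
    split_ifs with h
    · rfl
    · simp
  rw [Finset.sum_congr rfl fun r hr => by rw [hslice r hr]]
  -- collect: the offsets off the face contribute `0`, the face offsets a finite sum inside the `w`-series
  have h2 : ∀ r ∈ box (d + 1) P,
      (∑' w : Site (d + 1), if r κ = P - 1 then t' κ ((P : ℤ) • w + toSite r) * (θ₀ * F w + θ₁ * F (w + unitVec κ)) * (G (w + unitVec κ) - G w) else 0)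
        = if r κ = P - 1 then ∑' w : Site (d + 1), t' κ ((P : ℤ) • w + toSite r) * (θ₀ * F w + θ₁ * F (w + unitVec κ)) * (G (w + unitVec κ) - G w)
          else 0 := by
    intro r _
    split_ifs <;> simp
  rw [Finset.sum_congr rfl h2, ← Finset.sum_filter]
  -- swap the finite face sum with the series
  have hsl : ∀ r ∈ (box (d + 1) P).filter (fun r => r κ = P - 1), Summable fun w : Site (d + 1) =>
      t' κ ((P : ℤ) • w + toSite r) * (θ₀ * F w + θ₁ * F (w + unitVec κ)) * (G (w + unitVec κ) - G w) := by
    intro r hr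
    have hr' := (Finset.mem_filter.1 hr).1
    have h := hs.comp_injective (InterLevelTransport.sublattice_injective P (toSite r))
    have e : ((fun u' : Site (d + 1) =>
        t' κ u' * (θ₀ * F (blk P u') + θ₁ * F (blk P (u' + unitVec κ))) * (G (blk P (u' + unitVec κ)) - G (blk P u'))) ∘
        fun t : Site (d + 1) => (P : ℤ) • t + toSite r)
        = fun w => t' κ ((P : ℤ) • w + toSite r) * (θ₀ * F w + θ₁ * F (w + unitVec κ)) * (G (w + unitVec κ) - G w) := by
      funext w
      simp only [Function.comp_apply]
      rw [blk_block w hr', blk_cell_add_unitVec hP w hr' κ, if_pos (Finset.mem_filter.1 hr).2]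
    rw [e] at h
    exact h
  rw [← Summable.tsum_finsetSum hsl]
  refine tsum_congr fun w => ?_
  rw [Finset.sum_mul, Finset.sum_mul]

/-- NOT IN PRINT; OUR BOOKKEEPING.  **THE TRANSPORTED PAIRING OF A FINE′ TENT IS `P^{d+1} ×` THE COARSE PAIRING OF THE COARSE TENT OF THE SAME KERNEL, ANY
BOND READING** (generic `d`, `1 ≤ P`): with `t′ = 𝒬ᵀ_{P·N} φ′`,
`Σ'_{u′} t′ κ u′·(θ₀·F (blk P u′) + θ₁·F (blk P (u′+e_κ)))·(G (blk P (u′+e_κ)) − G (blk P u′)) = (P^d·P) · Σ'_w (𝒬ᵀ_N φ′) κ w·(θ₀·F w + θ₁·F (w+e_κ))·(G (w+e_κ) − G w)`. -/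
theorem tsum_transport_pairingReading_contourSumAdj {P : ℕ} (hP : 1 ≤ P) (N : ℕ) (φ' : Form1 (d + 1) ℝ) (F G : Form0 (d + 1) ℝ) (θ₀ θ₁ : ℝ)
    (κ : Fin (d + 1))
    (hs : Summable fun u' : Site (d + 1) =>
      contourSumAdj (P * N) φ' κ u' * (θ₀ * F (blk P u') + θ₁ * F (blk P (u' + unitVec κ))) * (G (blk P (u' + unitVec κ)) - G (blk P u'))) :
    ∑' u' : Site (d + 1), contourSumAdj (P * N) φ' κ u' * (θ₀ * F (blk P u') + θ₁ * F (blk P (u' + unitVec κ)))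
        * (G (blk P (u' + unitVec κ)) - G (blk P u'))
      = ((P : ℝ) ^ d * P) * ∑' w : Site (d + 1), contourSumAdj N φ' κ w * (θ₀ * F w + θ₁ * F (w + unitVec κ)) * (G (w + unitVec κ) - G w) := by
  rw [tsum_transport_pairingReading_eq hP _ F G θ₀ θ₁ κ hs, ← tsum_mul_left]
  refine tsum_congr fun w => ?_
  rw [sum_farFace_contourSumAdj_mul hP N φ' κ w]
  ring

/-- NOT IN PRINT; OUR BOOKKEEPING.  **THE MIDPOINT READING** (the owner's `StaircasePairing.abs_pairing_le_sum` shape `(F u + F (u+e_κ))∕2`): with `t′ = 𝒬ᵀ_{P·N} φ′`,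
`Σ'_{u′} t′ κ u′·((F (blk P u′) + F (blk P (u′+e_κ)))∕2)·(G (blk P (u′+e_κ)) − G (blk P u′)) = (P^d·P) · Σ'_w (𝒬ᵀ_N φ′) κ w·((F w + F (w+e_κ))∕2)·(G (w+e_κ) − G w)`. -/
theorem tsum_transport_pairing_contourSumAdj {P : ℕ} (hP : 1 ≤ P) (N : ℕ) (φ' : Form1 (d + 1) ℝ) (F G : Form0 (d + 1) ℝ) (κ : Fin (d + 1))
    (hs : Summable fun u' : Site (d + 1) =>
      contourSumAdj (P * N) φ' κ u' * ((F (blk P u') + F (blk P (u' + unitVec κ))) / 2) * (G (blk P (u' + unitVec κ)) - G (blk P u'))) :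
    ∑' u' : Site (d + 1), contourSumAdj (P * N) φ' κ u' * ((F (blk P u') + F (blk P (u' + unitVec κ))) / 2)
        * (G (blk P (u' + unitVec κ)) - G (blk P u'))
      = ((P : ℝ) ^ d * P) * ∑' w : Site (d + 1), contourSumAdj N φ' κ w * ((F w + F (w + unitVec κ)) / 2) * (G (w + unitVec κ) - G w) := by
  have e1 : (fun u' : Site (d + 1) =>
      contourSumAdj (P * N) φ' κ u' * ((F (blk P u') + F (blk P (u' + unitVec κ))) / 2) * (G (blk P (u' + unitVec κ)) - G (blk P u')))
      = fun u' => contourSumAdj (P * N) φ' κ u' * ((1 / 2 : ℝ) * F (blk P u') + (1 / 2 : ℝ) * F (blk P (u' + unitVec κ)))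
          * (G (blk P (u' + unitVec κ)) - G (blk P u')) := by
    funext u'; ring
  have e2 : (fun w : Site (d + 1) => contourSumAdj N φ' κ w * ((F w + F (w + unitVec κ)) / 2) * (G (w + unitVec κ) - G w))
      = fun w => contourSumAdj N φ' κ w * ((1 / 2 : ℝ) * F w + (1 / 2 : ℝ) * F (w + unitVec κ)) * (G (w + unitVec κ) - G w) := by
    funext w; ring
  rw [e1] at hs
  rw [show (∑' u' : Site (d + 1), contourSumAdj (P * N) φ' κ u' * ((F (blk P u') + F (blk P (u' + unitVec κ))) / 2)
        * (G (blk P (u' + unitVec κ)) - G (blk P u'))) = ∑' u' : Site (d + 1), (fun u' => contourSumAdj (P * N) φ' κ u'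
        * ((1 / 2 : ℝ) * F (blk P u') + (1 / 2 : ℝ) * F (blk P (u' + unitVec κ))) * (G (blk P (u' + unitVec κ)) - G (blk P u'))) u'
      from congrArg tsum e1,
    show (∑' w : Site (d + 1), contourSumAdj N φ' κ w * ((F w + F (w + unitVec κ)) / 2) * (G (w + unitVec κ) - G w))
        = ∑' w : Site (d + 1), (fun w => contourSumAdj N φ' κ w * ((1 / 2 : ℝ) * F w + (1 / 2 : ℝ) * F (w + unitVec κ)) * (G (w + unitVec κ) - G w)) w
      from congrArg tsum e2]
  exact tsum_transport_pairingReading_contourSumAdj hP N φ' F G (1 / 2) (1 / 2) κ hs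

end Summit.QuantumFields.BalabanUV.Beta.GAN24.ContactTentFaceAvg

end
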